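import Summits.QuantumAdvantage.QuantumAdvantage.Theorems.WalkFiniteStateRungTransfer

/-!
# Rung (G) `Coset21.TwoStepFiniteStateWalkHard 5` — part 4/6 — §7 `stub_dense : Contraction → DenseBound p`

VERBATIM split (for the 400-line rule) of planner qa-qnc0-p2 g22's `HOME/qa-qnc0-p2/line22/RungGCore.lean` v3 (sha16 `70defc48ef50f6ad`;
authored AND proved by the planner seat; landed by qn-prover-3 g14, ask P2-22d, `--supports stmt-QuantumAdvantage-28072`).
(+ one-line docstrings on undocumented auxiliaries, lint.)  See `WalkFiniteStateRungContraction.lean` for the planner's docstring.  WHAT THIS IS NOT: nothing about polynomial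
strategies or `LinSel`; separation NOT moved.
-/

noncomputable section

namespace Summit.QuantumAdvantage.AdviceFreeQNC0

namespace Coset21

namespace RungG

open Finset

variable {M : ℕ}

/-! ## §7 Lemma 4 + 6 (planner qa-qnc0-p2 g22): `stub_dense : Contraction → DenseBound p`

Work at modulus `M + 1 = 3p`.  `proj : ZMod (M+1) →+* ZMod p`; for a lift `w'` of the class `w` (`proj w' = w`) the fired-and-live
pattern of cut `g` is `pat … w' g x = T g (proj x) w ∧ (c + g + w'.val + x.val) % 3 ≠ 0`, a function of the path state
`x = wtPrefix u g (mod 3p)` alone once `wt u ≡ w' (mod 3p)`.  Then `2·#win_{w'} = #class_{w'} − S(w')` with `S(w')` the signed sum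
of §6, `|S(w')| ≤ 2^n (1-κ)^(A/2-1)` by §5 (both pairings; an ACTIVE cut has a non-constant pattern: the three lifts `x₅, x₅+p, x₅+2p`
of a firing residue carry all three liveness residues since `3 ∤ p`), the class `w` is the disjoint union of `≤ 3` lift classes, and
`|#winIn − #classOf/2| ≤ Σ_{w'} |S(w')|/2 ≤ 3/2 · 2^n · (1-κ)^(A/2-1)`. -/

section Dense

variable {p : ℕ} {M : ℕ}

/-- The projection `ZMod (3p) → ZMod p`. -/
def proj (hM : M + 1 = 3 * p) : ZMod (M + 1) →+* ZMod p :=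
  ZMod.castHom (show p ∣ M + 1 from ⟨3, by omega⟩) (ZMod p)

/-- Auxiliary step `proj_natCast` of rung (G) (planner qa-qnc0-p2, `RungGCore.lean` v3, verbatim). -/
theorem proj_natCast (hM : M + 1 = 3 * p) (k : ℕ) : proj hM (k : ZMod (M + 1)) = (k : ZMod p) :=
  map_natCast (proj hM) k

/-- The fired-and-live pattern of cut `g` for the lift `w'` of the class `w`. -/
def pat (hM : M + 1 = 3 * p) {n : ℕ} (c : ℕ) (T : Fin (n + 1) → ZMod p → ZMod p → Bool) (w : ZMod p) (w' : ZMod (M + 1))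
    (g : Fin (n + 1)) : ZMod (M + 1) → Bool :=
  fun x => T g (proj hM x) w && decide ((c + g.val + w'.val + x.val) % 3 ≠ 0)

/-- Auxiliary step `mod_three_of_mod` of rung (G) (planner qa-qnc0-p2, `RungGCore.lean` v3, verbatim). -/
theorem mod_three_of_mod (hM : M + 1 = 3 * p) (c a b : ℕ) :
    (c + a % (M + 1) + b % (M + 1)) % 3 = (c + (a + b)) % 3 := by
  have h3 : 3 ∣ M + 1 := ⟨p, by omega⟩
  have ha : a % (M + 1) ≡ a [MOD 3] := (Nat.mod_modEq a (M + 1)).of_dvd h3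
  have hb : b % (M + 1) ≡ b [MOD 3] := (Nat.mod_modEq b (M + 1)).of_dvd h3
  have := ((Nat.ModEq.refl c).add ha).add hb
  rw [add_assoc c a b] at this
  exact this

/-- On the lift class `wt u ≡ w' (mod 3p)`, the pattern at the path state is exactly "fired and live". -/
theorem pat_apply_iff (hM : M + 1 = 3 * p) {n : ℕ} (c : ℕ) (T : Fin (n + 1) → ZMod p → ZMod p → Bool) (w : ZMod p)
    (w' : ZMod (M + 1)) (hw : proj hM w' = w) (g : Fin (n + 1)) (u : Fin n → Bool)
    (hu : ((wt u : ℕ) : ZMod (M + 1)) = w') :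
    pat hM c T w w' g ((wtPrefix u g.val : ℕ) : ZMod (M + 1)) = true ↔
      (yOf T g u = true ∧ (c + g.val + walkExp u g.val) % 3 ≠ 0) := by
  have hwp : ((wt u : ℕ) : ZMod p) = w := by rw [← proj_natCast hM, hu, hw]
  have hval : w'.val = wt u % (M + 1) := by rw [← hu, ZMod.val_natCast]
  simp only [pat, yOf, walkExp, Bool.and_eq_true, decide_eq_true_eq, proj_natCast, hwp, ZMod.val_natCast, hval,
    mod_three_of_mod hM]

/-- `∏ sgn = (-1)^(number of `true`s)`. -/
theorem prod_sgn_eq {n N : ℕ} (D : Fin (n + 1) → ZMod N → Bool) (x : Fin (n + 1) → ZMod N) :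
    ∏ g, sgn (D g) (x g) = (-1 : ℝ) ^ (univ.filter fun g => D g (x g) = true).card := by
  simp only [sgn]
  rw [Finset.prod_ite, Finset.prod_const, Finset.prod_const_one, mul_one]

/-- An ACTIVE cut has a non-constant pattern (needs `3 ∤ p`). -/
theorem pat_nonconst [Fact p.Prime] (hM : M + 1 = 3 * p) (hp3 : ¬ 3 ∣ p) {n : ℕ} (c : ℕ) (T : Fin (n + 1) → ZMod p → ZMod p → Bool)
    (w : ZMod p) (w' : ZMod (M + 1)) (g : Fin (n + 1)) (hA : Active T w g) :
    ∃ x y, pat hM c T w w' g x ≠ pat hM c T w w' g y := by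
  haveI : NeZero p := ⟨(Fact.out : p.Prime).ne_zero⟩
  obtain ⟨x₅, hx₅⟩ := hA
  have hx₅lt : x₅.val < p := ZMod.val_lt x₅
  -- the three lifts `x₅ + j·p`, `j = 0, 1, 2`
  have hlift : ∀ j : ℕ, j * p ≤ 2 * p →
      proj hM (((x₅.val + j * p : ℕ) : ZMod (M + 1))) = x₅ ∧ (((x₅.val + j * p : ℕ) : ZMod (M + 1))).val = x₅.val + j * p := by
    intro j hj
    refine ⟨?_, ?_⟩
    · rw [proj_natCast, Nat.cast_add, Nat.cast_mul, ZMod.natCast_self, mul_zero, add_zero, ZMod.natCast_zmod_val]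
    · rw [ZMod.val_natCast]
      exact Nat.mod_eq_of_lt (by omega)
  have hpat : ∀ j : ℕ, j * p ≤ 2 * p →
      pat hM c T w w' g (((x₅.val + j * p : ℕ) : ZMod (M + 1))) = decide ((c + g.val + w'.val + (x₅.val + j * p)) % 3 ≠ 0) := by
    intro j hj
    obtain ⟨h1, h2⟩ := hlift j hj
    simp only [pat, h1, hx₅, h2, Bool.true_and]
  have h0 := hpat 0 (by omega)
  have h1 := hpat 1 (by omega)
  have h2 := hpat 2 (by omega)
  simp only [zero_mul, add_zero, one_mul] at h0 h1 h2
  have hp3' : p % 3 = 1 ∨ p % 3 = 2 := by omega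
  set b := c + g.val + w'.val + x₅.val with hb
  -- among `b, b+p, b+2p` one is `≡ 0` and one is `≢ 0 (mod 3)`
  -- `pat` at two lifts with different liveness differs
  have hne : ∀ (x y : ZMod (M + 1)) (P Q : Prop) [Decidable P] [Decidable Q],
      pat hM c T w w' g x = decide P → pat hM c T w w' g y = decide Q → (P ↔ ¬ Q) → pat hM c T w w' g x ≠ pat hM c T w w' g y := by
    intro x y P Q _ _ hx hy hPQ
    rw [hx, hy]
    by_cases hP : P
    · have hQ : ¬ Q := hPQ.mp hP
      simp [hP, hQ]
    · have hQ : Q := by by_contra hQ; exact hP (hPQ.mpr hQ)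
      simp [hP, hQ]
  rcases hp3' with hp1 | hp2
  · have hcase : b % 3 = 0 ∨ b % 3 = 1 ∨ b % 3 = 2 := by omega
    rcases hcase with hb0 | hb1 | hb2
    · exact ⟨((x₅.val : ℕ) : ZMod (M + 1)), ((x₅.val + p : ℕ) : ZMod (M + 1)), hne _ _ _ _ h0 h1 (by omega)⟩
    · exact ⟨((x₅.val : ℕ) : ZMod (M + 1)), ((x₅.val + 2 * p : ℕ) : ZMod (M + 1)), hne _ _ _ _ h0 h2 (by omega)⟩
    · exact ⟨((x₅.val : ℕ) : ZMod (M + 1)), ((x₅.val + p : ℕ) : ZMod (M + 1)), hne _ _ _ _ h0 h1 (by omega)⟩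
  · have hcase : b % 3 = 0 ∨ b % 3 = 1 ∨ b % 3 = 2 := by omega
    rcases hcase with hb0 | hb1 | hb2
    · exact ⟨((x₅.val : ℕ) : ZMod (M + 1)), ((x₅.val + p : ℕ) : ZMod (M + 1)), hne _ _ _ _ h0 h1 (by omega)⟩
    · exact ⟨((x₅.val : ℕ) : ZMod (M + 1)), ((x₅.val + p : ℕ) : ZMod (M + 1)), hne _ _ _ _ h0 h1 (by omega)⟩
    · exact ⟨((x₅.val : ℕ) : ZMod (M + 1)), ((x₅.val + 2 * p : ℕ) : ZMod (M + 1)), hne _ _ _ _ h0 h2 (by omega)⟩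

/-- A class mod `p` has at most three lifts mod `3p`. -/
theorem card_lifts_le [Fact p.Prime] (hM : M + 1 = 3 * p) (w : ZMod p) :
    (univ.filter fun w' : ZMod (M + 1) => proj hM w' = w).card ≤ 3 := by
  haveI : NeZero p := ⟨(Fact.out : p.Prime).ne_zero⟩
  have hsub : (univ.filter fun w' : ZMod (M + 1) => proj hM w' = w) ⊆
      (Finset.range 3).image fun k => ((w.val + p * k : ℕ) : ZMod (M + 1)) := by
    intro w' hw'
    rw [Finset.mem_filter] at hw'
    obtain ⟨-, hw'⟩ := hw'
    rw [Finset.mem_image]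
    have hcast : ((w'.val : ℕ) : ZMod (M + 1)) = w' := ZMod.natCast_zmod_val w'
    have hmod : w'.val % p = w.val := by
      have h1 : proj hM ((w'.val : ℕ) : ZMod (M + 1)) = w := by rw [hcast, hw']
      rw [proj_natCast] at h1
      have h2 := congrArg ZMod.val h1
      rwa [ZMod.val_natCast] at h2
    have hlt : w'.val < M + 1 := ZMod.val_lt w'
    refine ⟨w'.val / p, ?_, ?_⟩
    · rw [Finset.mem_range, Nat.div_lt_iff_lt_mul (Fact.out : p.Prime).pos]
      omega
    · have h3 := Nat.mod_add_div w'.val p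
      rw [hmod] at h3
      rw [h3, hcast]
  calc (univ.filter fun w' : ZMod (M + 1) => proj hM w' = w).card
      ≤ ((Finset.range 3).image fun k => ((w.val + p * k : ℕ) : ZMod (M + 1))).card := Finset.card_le_card hsub
    _ ≤ (Finset.range 3).card := Finset.card_image_le
    _ = 3 := Finset.card_range 3

/-- Lift class and its winners. -/
def liftCl (M n : ℕ) (w' : ZMod (M + 1)) : Finset (Fin n → Bool) :=
  univ.filter fun u : Fin n → Bool => ((wt u : ℕ) : ZMod (M + 1)) = w'

/-- Auxiliary step `liftWin` of rung (G) (planner qa-qnc0-p2, `RungGCore.lean` v3, verbatim). -/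
def liftWin (M : ℕ) {n : ℕ} (c : ℕ) (T : Fin (n + 1) → ZMod p → ZMod p → Bool) (w' : ZMod (M + 1)) : Finset (Fin n → Bool) :=
  (liftCl M n w').filter fun u => ringWinU c (yOf T) u = true

/-- The signed sum of §6 for the patterns of the lift `w'` (start `0`, final weight `𝟙_{w'}`). -/
def sgnSum (hM : M + 1 = 3 * p) {n : ℕ} (c : ℕ) (T : Fin (n + 1) → ZMod p → ZMod p → Bool) (w : ZMod p)
    (w' : ZMod (M + 1)) : ℝ :=
  ∑ u : Fin n → Bool, (∏ g : Fin (n + 1), sgn (pat hM c T w w' g) (0 + ((wtPrefix u g.val : ℕ) : ZMod (M + 1)))) *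
    (fun x : ZMod (M + 1) => if x = w' then (1 : ℝ) else 0) (0 + ((wt u : ℕ) : ZMod (M + 1)))

/-- Auxiliary step `sgnSum_eq_prodOp` of rung (G) (planner qa-qnc0-p2, `RungGCore.lean` v3, verbatim). -/
theorem sgnSum_eq_prodOp (hM : M + 1 = 3 * p) {n : ℕ} (c : ℕ) (T : Fin (n + 1) → ZMod p → ZMod p → Bool) (w : ZMod p)
    (w' : ZMod (M + 1)) :
    sgnSum hM c T w w' = 2 ^ n * prodOp (List.ofFn fun i : Fin n => pat hM c T w w' (Fin.castSucc i))
      (signFlip (pat hM c T w w' (Fin.last n)) fun x => if x = w' then (1 : ℝ) else 0) 0 := by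
  unfold sgnSum
  exact transfer n (pat hM c T w w') (fun x => if x = w' then (1 : ℝ) else 0) 0

/-- `2 · #win_{w'} = #class_{w'} − S(w')`. -/
theorem two_mul_card_liftWin (hM : M + 1 = 3 * p) {n : ℕ} (c : ℕ) (T : Fin (n + 1) → ZMod p → ZMod p → Bool) (w : ZMod p)
    (w' : ZMod (M + 1)) (hw : proj hM w' = w) :
    2 * ((liftWin M c T w').card : ℝ) = ((liftCl M n w').card : ℝ) - sgnSum hM c T w w' := by
  have hW : ((liftWin M c T w').card : ℝ) =
      ∑ u : Fin n → Bool, (if ((wt u : ℕ) : ZMod (M + 1)) = w' ∧ ringWinU c (yOf T) u = true then (1 : ℝ) else 0) := by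
    unfold liftWin liftCl
    rw [Finset.filter_filter, Finset.card_filter]
    push_cast
    rfl
  have hC : ((liftCl M n w').card : ℝ) = ∑ u : Fin n → Bool, (if ((wt u : ℕ) : ZMod (M + 1)) = w' then (1 : ℝ) else 0) := by
    unfold liftCl
    rw [Finset.card_filter]
    push_cast
    rfl
  rw [hW, hC, sgnSum, Finset.mul_sum, ← Finset.sum_sub_distrib]
  refine Finset.sum_congr rfl fun u _ => ?_
  simp only [zero_add]
  by_cases hu : ((wt u : ℕ) : ZMod (M + 1)) = w'
  · simp only [hu, true_and, if_true, mul_one]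
    rw [prod_sgn_eq]
    -- the count is the fired-and-live count of `ringWinU`
    have hset : (univ.filter fun g : Fin (n + 1) => pat hM c T w w' g ((wtPrefix u g.val : ℕ) : ZMod (M + 1)) = true) =
        univ.filter fun g : Fin (n + 1) => yOf T g u = true ∧ (c + g.val + walkExp u g.val) % 3 ≠ 0 := by
      refine Finset.filter_congr fun g _ => ?_
      exact pat_apply_iff hM c T w w' hw g u hu
    rw [hset]
    set k := (univ.filter fun g : Fin (n + 1) => yOf T g u = true ∧ (c + g.val + walkExp u g.val) % 3 ≠ 0).card with hk
    have hwin : (ringWinU c (yOf T) u = true) ↔ k % 2 = 1 := by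
      unfold ringWinU
      rw [decide_eq_true_iff]
    rcases Nat.even_or_odd k with he | ho
    · rw [he.neg_one_pow]
      have hf : ¬ (ringWinU c (yOf T) u = true) := by rw [hwin]; rw [Nat.even_iff] at he; omega
      simp only [hf]; norm_num
    · rw [ho.neg_one_pow]
      have ht : ringWinU c (yOf T) u = true := by rw [hwin]; exact Nat.odd_iff.mp ho
      simp only [ht, if_true]; norm_num
  · simp [hu]

/-- The `ℓ²` mass of `D 𝟙_{w'}` is `1`. -/
theorem sumSq_signFlip_indicator {N : ℕ} (D : ZMod (N + 1) → Bool) (w' : ZMod (N + 1)) :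
    ∑ y, (signFlip D (fun x => if x = w' then (1 : ℝ) else 0) y) ^ 2 = 1 := by
  rw [sum_signFlip_sq]
  simp [Finset.sum_ite_eq', sq]

/-- `|S(w')| ≤ 2^n (1-κ)^(A/2 - 1)`. -/
theorem abs_sgnSum_le [Fact p.Prime] (hM : M + 1 = 3 * p) (hp3 : ¬ 3 ∣ p) (κ : ℝ) (hκ₀ : 0 ≤ κ) (hκ₁ : κ ≤ 1)
    (hC : ∀ D : ZMod (M + 1) → Bool, (∃ x y, D x ≠ D y) →
      ∀ v : ZMod (M + 1) → ℝ, ∑ x, (lazyStep (signFlip D (lazyStep v)) x) ^ 2 ≤ (1 - κ) ^ 2 * ∑ x, (v x) ^ 2)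
    {n : ℕ} (c : ℕ) (T : Fin (n + 1) → ZMod p → ZMod p → Bool) (w : ZMod p) (w' : ZMod (M + 1)) :
    |sgnSum hM c T w w'| ≤ (2 : ℝ) ^ n * (1 - κ) ^ (activeCount T w / 2 - 1) := by
  classical
  have h1κ : 0 ≤ 1 - κ := by linarith
  have h1κ' : 1 - κ ≤ 1 := by linarith
  rw [sgnSum_eq_prodOp, abs_mul, abs_of_nonneg (by positivity : (0 : ℝ) ≤ 2 ^ n)]
  refine mul_le_mul_of_nonneg_left ?_ (by positivity)
  -- the tagged list
  set f := fun i : Fin n => pat hM c T w w' (Fin.castSucc i) with hf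
  set tg := fun i : Fin n => decide (Active T w (Fin.castSucc i)) with htg
  set L : List ((ZMod (M + 1) → Bool) × Bool) := List.ofFn fun i : Fin n => (f i, tg i) with hL
  set acc := signFlip (pat hM c T w w' (Fin.last n)) fun x => if x = w' then (1 : ℝ) else 0 with hacc
  have hLfst : L.map Prod.fst = List.ofFn f := by rw [hL, List.map_ofFn]; rfl
  have hLsnd : L.map Prod.snd = List.ofFn tg := by rw [hL, List.map_ofFn]; rfl
  have hLtag : ∀ q ∈ L, q.2 = true → ∃ x y, q.1 x ≠ q.1 y := by
    intro q hq hq2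
    rw [hL, List.mem_ofFn] at hq
    obtain ⟨i, rfl⟩ := hq
    simp only [htg, decide_eq_true_eq] at hq2
    exact pat_nonconst hM hp3 c T w w' _ hq2
  have hacc1 : ∑ y, (acc y) ^ 2 = 1 := sumSq_signFlip_indicator _ w'
  -- bound 1: odd pairing
  have hb1 : |prodOp (List.ofFn f) acc 0| ≤ (1 - κ) ^ oddTagged (List.ofFn tg) := by
    have := abs_prodOp_apply_le κ hκ₀ hκ₁ hC L hLtag acc 0
    rwa [hLfst, hLsnd, hacc1, Real.sqrt_one, mul_one] at this
  -- active count vs tags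
  have hA : activeCount T w = (∑ i : Fin n, (tg i).toNat) + (decide (Active T w (Fin.last n))).toNat := by
    unfold activeCount
    rw [Finset.card_filter, Fin.sum_univ_castSucc]
    congr 1
    · refine Finset.sum_congr rfl fun i _ => ?_
      simp only [htg, Bool.toNat]
      split_ifs <;> simp_all
    · simp only [Bool.toNat]
      split_ifs <;> simp_all
  have htn : (decide (Active T w (Fin.last n))).toNat ≤ 1 := Bool.toNat_le _
  rcases n with _ | n'
  · -- no interior cuts: exponent is `0`
    have hA0 : activeCount T w / 2 - 1 = 0 := by
      rw [hA]; simp only [Finset.univ_eq_empty, Finset.sum_empty, zero_add]; omega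
    rw [hA0, pow_zero]
    calc |prodOp (List.ofFn f) acc 0| ≤ (1 - κ) ^ oddTagged (List.ofFn tg) := hb1
      _ ≤ 1 := pow_le_one₀ h1κ h1κ'
  · -- bound 2: even pairing (drop the head, contract inside the tail)
    set L' : List ((ZMod (M + 1) → Bool) × Bool) := List.ofFn fun i : Fin n' => (f i.succ, tg i.succ) with hL'
    have hLcons : L = (f 0, tg 0) :: L' := by rw [hL, List.ofFn_succ]
    have hL'tag : ∀ q ∈ L', q.2 = true → ∃ x y, q.1 x ≠ q.1 y := fun q hq => hLtag q (by rw [hLcons]; exact List.mem_cons_of_mem _ hq)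
    have hfcons : List.ofFn f = f 0 :: L'.map Prod.fst := by
      rw [← hLfst, hLcons, List.map_cons]
    have htcons : List.ofFn tg = tg 0 :: L'.map Prod.snd := by
      rw [← hLsnd, hLcons, List.map_cons]
    have hb2 : |prodOp (List.ofFn f) acc 0| ≤ (1 - κ) ^ oddTagged (L'.map Prod.snd) := by
      rw [hfcons, prodOp_cons, signFlip_apply_eq, abs_mul]
      have hs : |sgn (f 0) 0| = 1 := by unfold sgn; split_ifs <;> simp
      rw [hs, one_mul]
      simp only [lazyStep]
      have r0 := abs_prodOp_apply_le κ hκ₀ hκ₁ hC L' hL'tag acc 0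
      have r1 := abs_prodOp_apply_le κ hκ₀ hκ₁ hC L' hL'tag acc (0 + 1)
      rw [hacc1, Real.sqrt_one, mul_one] at r0 r1
      calc |(prodOp (L'.map Prod.fst) acc 0 + prodOp (L'.map Prod.fst) acc (0 + 1)) / 2|
          = |prodOp (L'.map Prod.fst) acc 0 + prodOp (L'.map Prod.fst) acc (0 + 1)| / 2 := by
            rw [abs_div, abs_two]
        _ ≤ (|prodOp (L'.map Prod.fst) acc 0| + |prodOp (L'.map Prod.fst) acc (0 + 1)|) / 2 := by
            gcongr; exact abs_add_le _ _
        _ ≤ ((1 - κ) ^ oddTagged (L'.map Prod.snd) + (1 - κ) ^ oddTagged (L'.map Prod.snd)) / 2 := by gcongr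
        _ = (1 - κ) ^ oddTagged (L'.map Prod.snd) := by ring
    -- exponents: j₁ + j₂ = tagCount (tail tags) ≥ A - 2
    have hsum : oddTagged (L'.map Prod.snd) + oddTagged (List.ofFn tg) = tagCount (L'.map Prod.snd) := by
      rw [htcons]; exact oddTagged_add_oddTagged_cons (tg 0) _
    have htc : tagCount (List.ofFn tg) = ∑ i : Fin (n' + 1), (tg i).toNat := tagCount_ofFn _ tg
    have htc' : tagCount (List.ofFn tg) = (tg 0).toNat + tagCount (L'.map Prod.snd) := by
      rw [htcons]; rfl
    have ht0 : (tg 0).toNat ≤ 1 := Bool.toNat_le _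
    have hexp : activeCount T w / 2 - 1 ≤ oddTagged (List.ofFn tg) ∨ activeCount T w / 2 - 1 ≤ oddTagged (L'.map Prod.snd) := by
      rw [hA, ← htc]; omega
    rcases hexp with hj | hj
    · exact hb1.trans (pow_le_pow_of_le_one h1κ h1κ' hj)
    · exact hb2.trans (pow_le_pow_of_le_one h1κ h1κ' hj)

/-- **Main dense bound** at modulus `M + 1 = 3p`. -/
theorem dense_main [Fact p.Prime] (hM : M + 1 = 3 * p) (hp3 : ¬ 3 ∣ p) (κ : ℝ) (hκ₀ : 0 ≤ κ) (hκ₁ : κ ≤ 1)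
    (hC : ∀ D : ZMod (M + 1) → Bool, (∃ x y, D x ≠ D y) →
      ∀ v : ZMod (M + 1) → ℝ, ∑ x, (lazyStep (signFlip D (lazyStep v)) x) ^ 2 ≤ (1 - κ) ^ 2 * ∑ x, (v x) ^ 2)
    (n c : ℕ) (T : Fin (n + 1) → ZMod p → ZMod p → Bool) (w : ZMod p) :
    |((winIn c T w).card : ℝ) - ((classOf p w : Finset (Fin n → Bool)).card : ℝ) / 2|
      ≤ 3 / 2 * (2 : ℝ) ^ n * (1 - κ) ^ (activeCount T w / 2 - 1) := by
  classical
  set Λ := (univ.filter fun w' : ZMod (M + 1) => proj hM w' = w) with hΛ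
  have hmem : ∀ u : Fin n → Bool, u ∈ classOf p w → ((wt u : ℕ) : ZMod (M + 1)) ∈ Λ := by
    intro u hu
    unfold classOf at hu
    rw [Finset.mem_filter] at hu
    rw [hΛ, Finset.mem_filter, proj_natCast]
    exact ⟨Finset.mem_univ _, hu.2⟩
  -- fiberwise decomposition of the class and of the winners
  have hcl : ((classOf p w : Finset (Fin n → Bool)).card : ℝ) = ∑ w' ∈ Λ, ((liftCl M n w').card : ℝ) := by
    rw [Finset.card_eq_sum_card_fiberwise (f := fun u : Fin n → Bool => ((wt u : ℕ) : ZMod (M + 1))) hmem]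
    push_cast
    refine Finset.sum_congr rfl fun w' hw' => ?_
    rw [hΛ, Finset.mem_filter] at hw'
    congr 2
    ext u
    unfold classOf liftCl
    simp only [Finset.mem_filter, Finset.mem_univ, true_and]
    constructor
    · exact fun h => h.2
    · intro h; refine ⟨?_, h⟩; rw [← proj_natCast hM, h, hw'.2]
  have hmemW : ∀ u : Fin n → Bool, u ∈ winIn c T w → ((wt u : ℕ) : ZMod (M + 1)) ∈ Λ := by
    intro u hu
    unfold winIn at hu
    rw [Finset.mem_filter] at hu
    rw [hΛ, Finset.mem_filter, proj_natCast]
    exact ⟨Finset.mem_univ _, hu.2⟩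
  have hwi : ((winIn c T w).card : ℝ) = ∑ w' ∈ Λ, ((liftWin M c T w').card : ℝ) := by
    rw [Finset.card_eq_sum_card_fiberwise (f := fun u : Fin n → Bool => ((wt u : ℕ) : ZMod (M + 1))) hmemW]
    push_cast
    refine Finset.sum_congr rfl fun w' hw' => ?_
    rw [hΛ, Finset.mem_filter] at hw'
    congr 2
    ext u
    unfold winIn liftWin liftCl
    simp only [Finset.mem_filter, Finset.mem_univ, true_and]
    constructor
    · exact fun h => ⟨h.2, h.1.1⟩
    · intro h; refine ⟨⟨h.2, ?_⟩, h.1⟩; rw [← proj_natCast hM, h.1, hw'.2]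
  -- per lift: `#win − #class/2 = −S/2`
  have hper : ∀ w' ∈ Λ, ((liftWin M c T w').card : ℝ) - ((liftCl M n w').card : ℝ) / 2 = - sgnSum hM c T w w' / 2 := by
    intro w' hw'
    rw [hΛ, Finset.mem_filter] at hw'
    have := two_mul_card_liftWin hM c T w w' hw'.2
    linarith
  rw [hwi, hcl, Finset.sum_div, ← Finset.sum_sub_distrib, Finset.sum_congr rfl hper]
  calc |∑ w' ∈ Λ, - sgnSum hM c T w w' / 2| ≤ ∑ w' ∈ Λ, |- sgnSum hM c T w w' / 2| := Finset.abs_sum_le_sum_abs _ _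
    _ ≤ ∑ w' ∈ Λ, (2 : ℝ) ^ n * (1 - κ) ^ (activeCount T w / 2 - 1) / 2 := by
        refine Finset.sum_le_sum fun w' _ => ?_
        rw [abs_div, abs_neg, abs_two]
        gcongr
        exact abs_sgnSum_le hM hp3 κ hκ₀ hκ₁ hC c T w w'
    _ = (Λ.card : ℝ) * ((2 : ℝ) ^ n * (1 - κ) ^ (activeCount T w / 2 - 1) / 2) := by rw [Finset.sum_const, nsmul_eq_mul]
    _ ≤ 3 * ((2 : ℝ) ^ n * (1 - κ) ^ (activeCount T w / 2 - 1) / 2) := by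
        have h3 : (Λ.card : ℝ) ≤ 3 := by exact_mod_cast card_lifts_le hM w
        have hnn : 0 ≤ (2 : ℝ) ^ n * (1 - κ) ^ (activeCount T w / 2 - 1) / 2 := by
          have : 0 ≤ 1 - κ := by linarith
          positivity
        exact mul_le_mul_of_nonneg_right h3 hnn
    _ = 3 / 2 * (2 : ℝ) ^ n * (1 - κ) ^ (activeCount T w / 2 - 1) := by ring

end Dense

/-- **Lemma 4 + 6 (`stub_dense`)**: the dense-active bias bound, from `Contraction` at modulus `3p`. -/
theorem stub_dense (p : ℕ) [Fact p.Prime] (hp : 5 ≤ p) : Contraction → DenseBound p := by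
  intro hCon
  have hM : 3 * p - 1 + 1 = 3 * p := by omega
  have hp3 : ¬ 3 ∣ p := by
    intro h
    have := (Nat.Prime.eq_one_or_self_of_dvd (Fact.out : p.Prime) 3 h)
    omega
  obtain ⟨κ, hκ₀, hκ₁, hC⟩ := hCon (3 * p - 1)
  exact ⟨κ, hκ₀, hκ₁, fun n c T w => dense_main hM hp3 κ hκ₀.le hκ₁ hC n c T w⟩


end RungG

end Coset21

end Summit.QuantumAdvantage.AdviceFreeQNC0
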